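import Literature.Computability.Complexity.PolyExistsNTIMEArith
import Literature.Computability.Complexity.ExpPadding
import HarnessLib

/-!
# Stack programs for the `∃`-closure of `NSUBEXP`: the unary arithmetic routines

Second of five files of the proof of `polyExists_NSUBEXP_subset_NSUBEXP` (`AaronsonVanMelkebeek2011.lean`).
The new verifier (see `PolyExistsNTIME.lean` for the architecture) is assembled from the tree's
truncating wrapper `truncMapAux` (`TruncMapMachine.lean`), the given verifier of the inner
language, and two structured stack programs over the alphabet `Bool` (`ACom`,
`SymbolPrograms.lean`, compiled to Mathlib's `FinTM2` with exact cost by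
`ACom.exists_computesInTime`):

* the **clock** `x ↦ ⟨x, 1^{U(|x|)}⟩` telling the wrapper how much of the witness to keep, and
* the **shuffle** `⟨x, v⟩ ↦ ⟨⟨x, y⟩, z⟩` splitting the kept witness `v` into the witness `y` of
  the projection (at most `p(|x|)` bits) and the certificate `z` of the inner verifier (at most
  `c' · 2^{⌊m^{1/r'}⌋} + c'` symbols, `m = |⟨x, y⟩|`).

Both need the same unary arithmetic, provided here on a common register file `Rg` in the
style of `ExpPadding.lean` (stores written `PEx.mk`, one argument per register, with
read-out/update `simp` lemmas; every routine has a `runs_*` specification with an explicit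
cost): addition and multiplication by a preserved register (`addNB`, `mulAN`, `addSF`, `mulBS`),
**polynomial evaluation by Horner's rule** (`horner`, value `hornerVal`, and
`hornerVal_coeffList : hornerVal n (coeffList p) = p.eval n`), powers (`powS`), comparison
(`cmpBM`), the **integer root** `⌊m^{1/r}⌋` by upward search (`rootLoop`, `runs_root`), and the
exponential `2^s` by doubling (`dblE`, `runs_exp2`). The two programs themselves are in
`PolyExistsNTIMEClock.lean` and `PolyExistsNTIMEShuffle.lean`.

## References

* T. Nipkow, G. Klein, *Concrete Semantics with Isabelle/HOL*, Springer 2014, Ch. 7 (big-step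
  cost semantics; loop rule with invariant) — the verification style of `SymbolPrograms.lean`.
* S. Arora, B. Barak, *Computational Complexity: A Modern Approach*, CUP 2009, §1.3.
-/

namespace Literature.Computability.Complexity

namespace PolyExistsNTIME

open ACom ExpPad

/-! ### Registers and stores -/

/-- Registers of the clock and shuffle programs: `inp`/`out` are the input and output stacks of
the compiled machine; `xr` holds the (reversed) first component `x`, `n` its length in unary;
`a`, `b`, `t`, `m`, `s`, `e`, `f` are unary arithmetic registers (accumulator, products and
scratch, the length `m`, the root `s`, the exponential `e`); `yr`, `zr` hold the (reversed)
witness parts `y`, `z` (shuffle only). [folklore] -/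
inductive Rg
  | inp | xr | n | a | b | t | m | s | e | f | yr | zr | out
  deriving DecidableEq, Fintype

/-- Stores of the programs. [folklore] -/
abbrev Store : Type := AStore Bool Rg

/-- Programs over the registers `Rg` and the alphabet `Bool`. [folklore] -/
abbrev Prog : Type := ACom Bool Rg

/-- The store with prescribed register contents (one argument per register, in the order of
`Rg`). [folklore] -/
def mk (i xr n a b t m s e f yr zr o : List Bool) : Store
  | .inp => i
  | .xr => xr
  | .n => n
  | .a => a
  | .b => b
  | .t => t
  | .m => m
  | .s => s
  | .e => e
  | .f => f
  | .yr => yr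
  | .zr => zr
  | .out => o

section MkLemmas

variable (i xr n a b t m s e f yr zr o v : List Bool)

/-- Read-out of `inp`. [folklore] -/
@[simp] theorem mk_inp : mk i xr n a b t m s e f yr zr o .inp = i := rfl
/-- Read-out of `xr`. [folklore] -/
@[simp] theorem mk_xr : mk i xr n a b t m s e f yr zr o .xr = xr := rfl
/-- Read-out of `n`. [folklore] -/
@[simp] theorem mk_n : mk i xr n a b t m s e f yr zr o .n = n := rfl
/-- Read-out of `a`. [folklore] -/
@[simp] theorem mk_a : mk i xr n a b t m s e f yr zr o .a = a := rfl
/-- Read-out of `b`. [folklore] -/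
@[simp] theorem mk_b : mk i xr n a b t m s e f yr zr o .b = b := rfl
/-- Read-out of `t`. [folklore] -/
@[simp] theorem mk_t : mk i xr n a b t m s e f yr zr o .t = t := rfl
/-- Read-out of `m`. [folklore] -/
@[simp] theorem mk_m : mk i xr n a b t m s e f yr zr o .m = m := rfl
/-- Read-out of `s`. [folklore] -/
@[simp] theorem mk_s : mk i xr n a b t m s e f yr zr o .s = s := rfl
/-- Read-out of `e`. [folklore] -/
@[simp] theorem mk_e : mk i xr n a b t m s e f yr zr o .e = e := rfl
/-- Read-out of `f`. [folklore] -/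
@[simp] theorem mk_f : mk i xr n a b t m s e f yr zr o .f = f := rfl
/-- Read-out of `yr`. [folklore] -/
@[simp] theorem mk_yr : mk i xr n a b t m s e f yr zr o .yr = yr := rfl
/-- Read-out of `zr`. [folklore] -/
@[simp] theorem mk_zr : mk i xr n a b t m s e f yr zr o .zr = zr := rfl
/-- Read-out of `out`. [folklore] -/
@[simp] theorem mk_out : mk i xr n a b t m s e f yr zr o .out = o := rfl

/-- Update of `inp`. [folklore] -/
@[simp] theorem update_mk_inp :
    Function.update (mk i xr n a b t m s e f yr zr o) .inp v = mk v xr n a b t m s e f yr zr o := by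
  funext r; cases r <;> rfl
/-- Update of `xr`. [folklore] -/
@[simp] theorem update_mk_xr :
    Function.update (mk i xr n a b t m s e f yr zr o) .xr v = mk i v n a b t m s e f yr zr o := by
  funext r; cases r <;> rfl
/-- Update of `n`. [folklore] -/
@[simp] theorem update_mk_n :
    Function.update (mk i xr n a b t m s e f yr zr o) .n v = mk i xr v a b t m s e f yr zr o := by
  funext r; cases r <;> rfl
/-- Update of `a`. [folklore] -/
@[simp] theorem update_mk_a :
    Function.update (mk i xr n a b t m s e f yr zr o) .a v = mk i xr n v b t m s e f yr zr o := by
  funext r; cases r <;> rfl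
/-- Update of `b`. [folklore] -/
@[simp] theorem update_mk_b :
    Function.update (mk i xr n a b t m s e f yr zr o) .b v = mk i xr n a v t m s e f yr zr o := by
  funext r; cases r <;> rfl
/-- Update of `t`. [folklore] -/
@[simp] theorem update_mk_t :
    Function.update (mk i xr n a b t m s e f yr zr o) .t v = mk i xr n a b v m s e f yr zr o := by
  funext r; cases r <;> rfl
/-- Update of `m`. [folklore] -/
@[simp] theorem update_mk_m :
    Function.update (mk i xr n a b t m s e f yr zr o) .m v = mk i xr n a b t v s e f yr zr o := by
  funext r; cases r <;> rfl
/-- Update of `s`. [folklore] -/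
@[simp] theorem update_mk_s :
    Function.update (mk i xr n a b t m s e f yr zr o) .s v = mk i xr n a b t m v e f yr zr o := by
  funext r; cases r <;> rfl
/-- Update of `e`. [folklore] -/
@[simp] theorem update_mk_e :
    Function.update (mk i xr n a b t m s e f yr zr o) .e v = mk i xr n a b t m s v f yr zr o := by
  funext r; cases r <;> rfl
/-- Update of `f`. [folklore] -/
@[simp] theorem update_mk_f :
    Function.update (mk i xr n a b t m s e f yr zr o) .f v = mk i xr n a b t m s e v yr zr o := by
  funext r; cases r <;> rfl
/-- Update of `yr`. [folklore] -/
@[simp] theorem update_mk_yr :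
    Function.update (mk i xr n a b t m s e f yr zr o) .yr v = mk i xr n a b t m s e f v zr o := by
  funext r; cases r <;> rfl
/-- Update of `zr`. [folklore] -/
@[simp] theorem update_mk_zr :
    Function.update (mk i xr n a b t m s e f yr zr o) .zr v = mk i xr n a b t m s e f yr v o := by
  funext r; cases r <;> rfl
/-- Update of `out`. [folklore] -/
@[simp] theorem update_mk_out :
    Function.update (mk i xr n a b t m s e f yr zr o) .out v = mk i xr n a b t m s e f yr zr v := by
  funext r; cases r <;> rfl

end MkLemmas

/-- The all-empty store but for `inp`. [folklore] -/
theorem single_inp (x : List Bool) :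
    AStore.single .inp x = mk x [] [] [] [] [] [] [] [] [] [] [] [] := by
  funext r; cases r <;> rfl

/-- The all-empty store but for `out`. [folklore] -/
theorem single_out (w : List Bool) :
    AStore.single .out w = mk [] [] [] [] [] [] [] [] [] [] [] [] w := by
  funext r; cases r <;> rfl

/-- Unary words (an abbreviation shared with `ExpPadding.lean`). [folklore] -/
theorem un_succ (k : ℕ) : un (k + 1) = true :: un k := rfl

/-- `un (j + k) = un j ++ un k`. [folklore] -/
theorem un_add (j k : ℕ) : un (j + k) = un j ++ un k := by
  simp [un]

/-! ### Addition and multiplication by the preserved register `n` -/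

/-- `addNB`: add `|n|` tokens to `b`, keeping `n` (via the scratch register `t`). [folklore] -/
def addNB : Prog := loop .n (fun _ => push .b true ;; push .t true) ;; pour .t .n

/-- Effect and cost of `addNB`: `b := 1^k ++ b` for `n = 1^k`. [folklore] -/
theorem runs_addNB (i xr a b m s e f yr zr o : List Bool) (k : ℕ) :
    Runs addNB (mk i xr (un k) a b [] m s e f yr zr o) (mk i xr (un k) a (un k ++ b) [] m s e f yr zr o)
      (7 * k + 2) := by
  have h := runs_loop_inv (k := Rg.n) (f := fun _ => push .b true ;; push .t true)
    (fun done rest => mk i xr rest a (un done.length ++ b) (un done.length) m s e f yr zr o)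
    (fun _ _ => True) 2
    (fun _ _ _ => rfl)
    (fun done c rest _ => ⟨trivial, by
      refine ((Runs.push' rfl).seq (Runs.push' ?_)).of_eq rfl (by norm_num)
      simp [un, List.replicate_succ]⟩)
    (un k) [] trivial
  have h' : Runs (loop Rg.n fun _ => push Rg.b true ;; push Rg.t true)
      (mk i xr (un k) a b [] m s e f yr zr o) (mk i xr [] a (un k ++ b) (un k) m s e f yr zr o)
      (4 * k + 1) := by
    simpa [un] using h
  have h2 := runs_pour (Γ := Bool) (a := Rg.t) (b := Rg.n) (by decide)
    (mk i xr [] a (un k ++ b) (un k) m s e f yr zr o)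
  have h2' : Runs (pour Rg.t Rg.n) (mk i xr [] a (un k ++ b) (un k) m s e f yr zr o)
      (mk i xr (un k) a (un k ++ b) [] m s e f yr zr o) (3 * k + 1) := by
    simpa [un] using h2
  unfold addNB
  exact (h'.seq h2').of_eq rfl (by omega)

/-- `mulAN`: `a := 1^{A·k}` for `a = 1^A`, `n = 1^k` (repeated `addNB` into `b`, then pour `b`
back to `a`). [folklore] -/
def mulAN : Prog := loop .a (fun _ => addNB) ;; pour .b .a

/-- Effect and cost of `mulAN`. [folklore] -/
theorem runs_mulAN (i xr m s e f yr zr o : List Bool) (k A : ℕ) :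
    Runs mulAN (mk i xr (un k) (un A) [] [] m s e f yr zr o)
      (mk i xr (un k) (un (A * k)) [] [] m s e f yr zr o) ((7 * k + 4) * A + 3 * (A * k) + 2) := by
  have h := runs_loop_inv (k := Rg.a) (f := fun _ => addNB)
    (fun done rest => mk i xr (un k) rest (un (done.length * k)) [] m s e f yr zr o)
    (fun _ _ => True) (7 * k + 2)
    (fun _ _ _ => rfl)
    (fun done c rest _ => ⟨trivial, by
      rw [update_mk_a]
      refine (runs_addNB i xr rest (un (done.length * k)) m s e f yr zr o k).of_eq ?_ le_rfl
      simp [un, Nat.succ_mul, Nat.add_comm]⟩)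
    (un A) [] trivial
  have h' : Runs (loop Rg.a fun _ => addNB) (mk i xr (un k) (un A) [] [] m s e f yr zr o)
      (mk i xr (un k) [] (un (A * k)) [] m s e f yr zr o) ((7 * k + 2 + 2) * A + 1) := by
    simpa [un] using h
  have h2 := runs_pour (Γ := Bool) (a := Rg.b) (b := Rg.a) (by decide)
    (mk i xr (un k) [] (un (A * k)) [] m s e f yr zr o)
  have h2' : Runs (pour Rg.b Rg.a) (mk i xr (un k) [] (un (A * k)) [] m s e f yr zr o)
      (mk i xr (un k) (un (A * k)) [] [] m s e f yr zr o) (3 * (A * k) + 1) := by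
    simpa [un] using h2
  unfold mulAN
  exact (h'.seq h2').of_eq rfl (by ring_nf; omega)

/-! ### Polynomial evaluation by Horner's rule -/

/-- Horner value of a little-endian coefficient list at `k`:
`hornerVal k [c₀, c₁, …] = c₀ + k · (c₁ + k · (…))`. [folklore] -/
def hornerVal (k : ℕ) : List ℕ → ℕ
  | [] => 0
  | c :: ds => c + k * hornerVal k ds

/-- `horner ds`: evaluate the little-endian coefficient list `ds` at `|n|` into `a` (highest
coefficient first: recurse, multiply by `n`, add the coefficient). [folklore] -/
def horner : List ℕ → Prog
  | [] => skip
  | c :: ds => horner ds ;; mulAN ;; pushList .a (un c)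

/-- Cost of `horner ds` at `k`. [folklore] -/
def cHorner (k : ℕ) : List ℕ → ℕ
  | [] => 0
  | c :: ds => cHorner k ds + ((7 * k + 4) * hornerVal k ds + 3 * (hornerVal k ds * k) + 2) + c

/-- Effect and cost of `horner`: `a := 1^{hornerVal k ds}` from `a = []`, `n = 1^k` preserved.
[folklore] -/
theorem runs_horner (i xr m s e f yr zr o : List Bool) (k : ℕ) : ∀ ds : List ℕ,
    Runs (horner ds) (mk i xr (un k) [] [] [] m s e f yr zr o)
      (mk i xr (un k) (un (hornerVal k ds)) [] [] m s e f yr zr o) (cHorner k ds)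
  | [] => by simpa [horner, hornerVal, cHorner] using Runs.skip (mk i xr (un k) [] [] [] m s e f yr zr o)
  | c :: ds => by
    have h1 := runs_horner i xr m s e f yr zr o k ds
    have h2 := runs_mulAN i xr m s e f yr zr o k (hornerVal k ds)
    have h3 := runs_pushList (Γ := Bool) Rg.a (un c)
      (mk i xr (un k) (un (hornerVal k ds * k)) [] [] m s e f yr zr o)
    simp only [mk_a, update_mk_a, un, List.reverse_replicate, List.length_replicate,
      ← List.replicate_add] at h3
    have := h1.seq (h2.seq h3)
    simp only [horner, hornerVal, cHorner]
    refine this.of_eq ?_ (by omega)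
    simp [un, Nat.mul_comm]

/-- The little-endian coefficient list of a polynomial, up to its degree. [folklore] -/
noncomputable def coeffList (p : Polynomial ℕ) : List ℕ :=
  (List.range (p.natDegree + 1)).map p.coeff

/-- Horner over `(range K).map g` is the sum `∑_{i<K} g i · k^i`. [folklore] -/
theorem hornerVal_map_range (k : ℕ) : ∀ (K : ℕ) (g : ℕ → ℕ),
    hornerVal k ((List.range K).map g) = ∑ i ∈ Finset.range K, g i * k ^ i
  | 0, g => by simp [hornerVal]
  | K + 1, g => by
    rw [List.range_succ_eq_map, List.map_cons, List.map_map, hornerVal,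
      hornerVal_map_range k K (g ∘ Nat.succ), Finset.sum_range_succ', Finset.mul_sum]
    simp only [Function.comp, pow_zero, mul_one, pow_succ]
    rw [add_comm]
    congr 1
    exact Finset.sum_congr rfl fun i _ => by ring

/-- **Horner evaluates the polynomial**: `hornerVal n (coeffList p) = p(n)`. [folklore] -/
theorem hornerVal_coeffList (p : Polynomial ℕ) (k : ℕ) : hornerVal k (coeffList p) = p.eval k := by
  rw [coeffList, hornerVal_map_range, Polynomial.eval_eq_sum_range]

/-! ### Powers of the preserved register `s` -/

/-- `addSF`: add `|s|` tokens to `f`, keeping `s` (via `t`). [folklore] -/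
def addSF : Prog := loop .s (fun _ => push .f true ;; push .t true) ;; pour .t .s

/-- Effect and cost of `addSF`: `f := 1^σ ++ f` for `s = 1^σ`. [folklore] -/
theorem runs_addSF (i xr n a b m e f yr zr o : List Bool) (σ : ℕ) :
    Runs addSF (mk i xr n a b [] m (un σ) e f yr zr o) (mk i xr n a b [] m (un σ) e (un σ ++ f) yr zr o)
      (7 * σ + 2) := by
  have h := runs_loop_inv (k := Rg.s) (f := fun _ => push .f true ;; push .t true)
    (fun done rest => mk i xr n a b (un done.length) m rest e (un done.length ++ f) yr zr o)
    (fun _ _ => True) 2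
    (fun _ _ _ => rfl)
    (fun done c rest _ => ⟨trivial, by
      refine ((Runs.push' rfl).seq (Runs.push' ?_)).of_eq rfl (by norm_num)
      simp [un, List.replicate_succ]⟩)
    (un σ) [] trivial
  have h' : Runs (loop Rg.s fun _ => push Rg.f true ;; push Rg.t true)
      (mk i xr n a b [] m (un σ) e f yr zr o) (mk i xr n a b (un σ) m [] e (un σ ++ f) yr zr o)
      (4 * σ + 1) := by
    simpa [un] using h
  have h2 := runs_pour (Γ := Bool) (a := Rg.t) (b := Rg.s) (by decide)
    (mk i xr n a b (un σ) m [] e (un σ ++ f) yr zr o)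
  have h2' : Runs (pour Rg.t Rg.s) (mk i xr n a b (un σ) m [] e (un σ ++ f) yr zr o)
      (mk i xr n a b [] m (un σ) e (un σ ++ f) yr zr o) (3 * σ + 1) := by
    simpa [un] using h2
  unfold addSF
  exact (h'.seq h2').of_eq rfl (by omega)

/-- `mulBS`: `b := 1^{β·σ}` for `b = 1^β`, `s = 1^σ` (repeated `addSF` into `f`, poured back).
[folklore] -/
def mulBS : Prog := loop .b (fun _ => addSF) ;; pour .f .b

/-- Effect and cost of `mulBS`. [folklore] -/
theorem runs_mulBS (i xr n a m e yr zr o : List Bool) (σ β : ℕ) :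
    Runs mulBS (mk i xr n a (un β) [] m (un σ) e [] yr zr o)
      (mk i xr n a (un (β * σ)) [] m (un σ) e [] yr zr o) ((7 * σ + 4) * β + 3 * (β * σ) + 2) := by
  have h := runs_loop_inv (k := Rg.b) (f := fun _ => addSF)
    (fun done rest => mk i xr n a rest [] m (un σ) e (un (done.length * σ)) yr zr o)
    (fun _ _ => True) (7 * σ + 2)
    (fun _ _ _ => rfl)
    (fun done c rest _ => ⟨trivial, by
      rw [update_mk_b]
      refine (runs_addSF i xr n a rest m e (un (done.length * σ)) yr zr o σ).of_eq ?_ le_rfl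
      simp [un, Nat.succ_mul, Nat.add_comm]⟩)
    (un β) [] trivial
  have h' : Runs (loop Rg.b fun _ => addSF) (mk i xr n a (un β) [] m (un σ) e [] yr zr o)
      (mk i xr n a [] [] m (un σ) e (un (β * σ)) yr zr o) ((7 * σ + 2 + 2) * β + 1) := by
    simpa [un] using h
  have h2 := runs_pour (Γ := Bool) (a := Rg.f) (b := Rg.b) (by decide)
    (mk i xr n a [] [] m (un σ) e (un (β * σ)) yr zr o)
  have h2' : Runs (pour Rg.f Rg.b) (mk i xr n a [] [] m (un σ) e (un (β * σ)) yr zr o)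
      (mk i xr n a (un (β * σ)) [] m (un σ) e [] yr zr o) (3 * (β * σ) + 1) := by
    simpa [un] using h2
  unfold mulBS
  exact (h'.seq h2').of_eq rfl (by ring_nf; omega)

/-- `powS k`: `k` multiplications of `b` by `s`. [folklore] -/
def powS : ℕ → Prog
  | 0 => skip
  | k + 1 => powS k ;; mulBS

/-- Effect and cost of `powS k`: `b := 1^{σ^k}` from `b = 1`, cost `ExpPad.cPow σ k`. [folklore] -/
theorem runs_powS (i xr n a m e yr zr o : List Bool) (σ : ℕ) : ∀ k : ℕ,
    Runs (powS k) (mk i xr n a (un 1) [] m (un σ) e [] yr zr o)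
      (mk i xr n a (un (σ ^ k)) [] m (un σ) e [] yr zr o) (cPow σ k)
  | 0 => by simpa [powS, cPow] using Runs.skip (mk i xr n a (un 1) [] m (un σ) e [] yr zr o)
  | k + 1 => by
    have h := (runs_powS i xr n a m e yr zr o σ k).seq (runs_mulBS i xr n a m e yr zr o σ (σ ^ k))
    simpa [powS, cPow, pow_succ] using h

/-- `cPow` is monotone in the base. [folklore] -/
theorem cPow_mono {σ μ : ℕ} (h : σ ≤ μ) : ∀ k : ℕ, cPow σ k ≤ cPow μ k
  | 0 => by simp [cPow]
  | k + 1 => by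
    simp only [cPow]
    have := cPow_mono h k
    have h1 : σ ^ k ≤ μ ^ k := Nat.pow_le_pow_left h k
    gcongr

/-! ### Comparison of `b` with the preserved register `m` -/

/-- `cmpBM A B`: consume `b`, comparing its length with that of `m` (restored afterwards via
`t`); continue with `A` if `|b| ≤ |m|`, with `B` otherwise (the overshoot is collected in `f`
and cleared). [folklore] -/
def cmpBM (A B : Prog) : Prog :=
  loop .b (fun _ => pop .m fun o => match o with
    | some _ => push .t true
    | none => push .f true) ;;
  pour .t .m ;;
  pop .f fun o => match o with
    | some _ => clear .f ;; B
    | none => A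

/-- The comparison loop: after consuming `b = 1^β` against `m = 1^μ`, register `m` holds
`1^{μ - β}`, `t` holds `1^{min β μ}` and `f` holds `1^{β - μ}` (truncated subtractions).
[folklore] -/
theorem runs_cmpLoop (i xr n a s e yr zr o : List Bool) (β μ : ℕ) :
    Runs (loop .b (fun _ => pop .m fun o => match o with
        | some _ => push .t true
        | none => push .f true))
      (mk i xr n a (un β) [] (un μ) s e [] yr zr o)
      (mk i xr n a [] (un (min β μ)) (un (μ - β)) s e (un (β - μ)) yr zr o) (5 * β + 1) := by
  have h := runs_loop_inv (k := Rg.b) (f := fun _ => pop .m fun o => match o with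
        | some _ => push .t true
        | none => push .f true)
    (fun done rest => mk i xr n a rest (un (min done.length μ)) (un (μ - done.length)) s e
      (un (done.length - μ)) yr zr o)
    (fun _ _ => True) 3
    (fun _ _ _ => rfl)
    (fun done c rest _ => ⟨trivial, by
      rw [update_mk_b]
      by_cases hlt : done.length < μ
      · obtain ⟨d, hd⟩ : ∃ d, μ - done.length = d + 1 := ⟨μ - done.length - 1, by omega⟩
        have hm : un (μ - done.length) = true :: un d := by rw [hd, un_succ]
        refine (Runs.pop_cons (k := Rg.m) (by rw [mk_m, hm]) (Runs.push' ?_)).of_eq rfl (by norm_num)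
        rw [update_mk_m, update_mk_t, mk_t]
        have h1 : min (done.length + 1) μ = min done.length μ + 1 := by omega
        have h2 : μ - (done.length + 1) = d := by omega
        have h3 : done.length + 1 - μ = done.length - μ := by omega
        simp [h1, h2, h3, un_succ]
      · have hm : un (μ - done.length) = [] := by
          rw [show μ - done.length = 0 by omega]; rfl
        refine (Runs.pop_nil (k := Rg.m) (by rw [mk_m, hm]) (Runs.push' ?_)).of_eq rfl (by norm_num)
        rw [update_mk_f, mk_f]
        have h1 : min (done.length + 1) μ = min done.length μ := by omega
        have h2 : μ - (done.length + 1) = μ - done.length := by omega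
        have h3 : done.length + 1 - μ = (done.length - μ) + 1 := by omega
        simp [h1, h2, h3, un_succ]⟩)
    (un β) [] trivial
  simpa [un] using h

/-- `cmpBM` when `|b| ≤ |m|`: `A` is run on the store with `b` emptied and `m` intact.
[folklore] -/
theorem runs_cmpBM_le {A B : Prog} (i xr n a s e yr zr o : List Bool) {β μ : ℕ} (hle : β ≤ μ)
    {R' : Store} {C : ℕ} (hA : Runs A (mk i xr n a [] [] (un μ) s e [] yr zr o) R' C) :
    Runs (cmpBM A B) (mk i xr n a (un β) [] (un μ) s e [] yr zr o) R' (C + 8 * β + 4) := by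
  have h1 := runs_cmpLoop i xr n a s e yr zr o β μ
  rw [min_eq_left hle, Nat.sub_eq_zero_of_le hle] at h1
  have h2 := runs_pour (Γ := Bool) (a := Rg.t) (b := Rg.m) (by decide)
    (mk i xr n a [] (un β) (un (μ - β)) s e (un 0) yr zr o)
  have h2' : Runs (pour Rg.t Rg.m) (mk i xr n a [] (un β) (un (μ - β)) s e (un 0) yr zr o)
      (mk i xr n a [] [] (un μ) s e [] yr zr o) (3 * β + 1) := by
    have hμ : un β ++ un (μ - β) = un μ := by rw [← un_add]; congr 1; omega
    simpa [un, List.reverse_replicate] using (show Runs (pour Rg.t Rg.m) _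
      (mk i xr n a [] [] (un β ++ un (μ - β)) s e (un 0) yr zr o) (3 * β + 1) by
        simpa [un, List.reverse_replicate] using h2) |>.congr (by rw [hμ]; rfl)
  have h3 : Runs (pop Rg.f fun o => match o with
      | some _ => clear Rg.f ;; B
      | none => A) (mk i xr n a [] [] (un μ) s e [] yr zr o) R' (C + 2) :=
    Runs.pop_nil rfl hA
  unfold cmpBM
  exact (h1.seq (h2'.seq h3)).of_eq rfl (by omega)

/-- `cmpBM` when `|b| > |m|`: `B` is run on the store with `b` emptied and `m` intact.
[folklore] -/
theorem runs_cmpBM_gt {A B : Prog} (i xr n a s e yr zr o : List Bool) {β μ : ℕ} (hgt : μ < β)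
    {R' : Store} {C : ℕ} (hB : Runs B (mk i xr n a [] [] (un μ) s e [] yr zr o) R' C) :
    Runs (cmpBM A B) (mk i xr n a (un β) [] (un μ) s e [] yr zr o) R' (C + 8 * β + 4) := by
  have h1 := runs_cmpLoop i xr n a s e yr zr o β μ
  rw [min_eq_right hgt.le, Nat.sub_eq_zero_of_le hgt.le] at h1
  have h2 := runs_pour (Γ := Bool) (a := Rg.t) (b := Rg.m) (by decide)
    (mk i xr n a [] (un μ) (un 0) s e (un (β - μ)) yr zr o)
  have h2' : Runs (pour Rg.t Rg.m) (mk i xr n a [] (un μ) (un 0) s e (un (β - μ)) yr zr o)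
      (mk i xr n a [] [] (un μ) s e (un (β - μ)) yr zr o) (3 * μ + 1) := by
    simpa [un, List.reverse_replicate] using h2
  obtain ⟨d, hd⟩ : ∃ d, β - μ = d + 1 := ⟨β - μ - 1, by omega⟩
  have h4 := runs_clear (Γ := Bool) Rg.f (mk i xr n a [] [] (un μ) s e (un d) yr zr o)
  simp only [mk_f, update_mk_f, un, List.length_replicate] at h4
  have h3 : Runs (pop Rg.f fun o => match o with
      | some _ => clear Rg.f ;; B
      | none => A) (mk i xr n a [] [] (un μ) s e (un (β - μ)) yr zr o) R' (2 * d + 1 + C + 2) := by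
    refine Runs.pop_cons (k := Rg.f) (a := true) (w := un d) (by rw [mk_f, hd, un_succ]) ?_
    rw [update_mk_f]
    exact h4.seq hB
  unfold cmpBM
  exact (h1.seq (h2'.seq h3)).of_eq rfl (by omega)

/-! ### The integer root by upward search -/

/-- `rootLoop k`: while the flag `e` is set, try `s + 1`: compute `(s+1)^k` into `b` (`powS`),
compare with `m`; if `(s+1)^k ≤ m` keep the increment and re-set the flag, otherwise undo the
increment and let the loop end. Started at `s = 0` it ends with `s = ⌊m^{1/k}⌋`. [folklore] -/
def rootLoop (k : ℕ) : Prog :=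
  loop .e fun _ => push .s true ;; push .b true ;; powS k ;; cmpBM (push .e true) (pop .s fun _ => skip)

/-- A bound for the cost of one iteration of `rootLoop k` when `m = 1^μ` (all quantities in an
iteration are at most `(μ+1)^k`). [folklore] -/
def cRootIter (k μ : ℕ) : ℕ := cPow (μ + 1) k + 8 * (μ + 1) ^ k + 11

/-- **The root search**: from `s = 1^σ` with `σ^k ≤ μ` (`k ≠ 0`), flag set, `rootLoop k` ends
with `s = 1^{⌊μ^{1/k}⌋}` and the flag cleared, within `(μ + 2 - σ) · (cRootIter k μ + 2) + 1`
steps. [folklore] -/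
theorem runs_rootLoop {k : ℕ} (hk : k ≠ 0) (i xr n a yr zr o : List Bool) (μ : ℕ) :
    ∀ (gap σ : ℕ), μ + 1 - σ ≤ gap → σ ^ k ≤ μ →
      Runs (rootLoop k) (mk i xr n a [] [] (un μ) (un σ) [true] [] yr zr o)
        (mk i xr n a [] [] (un μ) (un (Nat.nthRoot k μ)) [] [] yr zr o)
        ((gap + 1) * (cRootIter k μ + 2) + 1) := by
  intro gap
  induction gap with
  | zero =>
    intro σ hgap hσ
    exfalso
    have : σ ≤ σ ^ k := Nat.le_self_pow hk σ
    omega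
  | succ gap ih =>
    intro σ hgap hσ
    have hσμ : σ ≤ μ := (Nat.le_self_pow hk σ).trans hσ
    -- one iteration
    have hpow := runs_powS i xr n a (un μ) [] yr zr o (σ + 1) k
    have hcpow : cPow (σ + 1) k ≤ cPow (μ + 1) k := cPow_mono (by omega) k
    have hpk : (σ + 1) ^ k ≤ (μ + 1) ^ k := Nat.pow_le_pow_left (by omega) k
    have h1 : Runs (push Rg.s true) (mk i xr n a [] [] (un μ) (un σ) [] [] yr zr o)
        (mk i xr n a [] [] (un μ) (un (σ + 1)) [] [] yr zr o) 1 := Runs.push' (by simp [un_succ])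
    have h2 : Runs (push Rg.b true) (mk i xr n a [] [] (un μ) (un (σ + 1)) [] [] yr zr o)
        (mk i xr n a (un 1) [] (un μ) (un (σ + 1)) [] [] yr zr o) 1 := Runs.push' (by simp [un])
    by_cases hle : (σ + 1) ^ k ≤ μ
    · -- continue: the flag is re-set and the induction hypothesis applies to `σ + 1`
      have hA : Runs (push Rg.e true) (mk i xr n a [] [] (un μ) (un (σ + 1)) [] [] yr zr o)
          (mk i xr n a [] [] (un μ) (un (σ + 1)) [true] [] yr zr o) 1 := Runs.push' (by simp)
      have hcmp := runs_cmpBM_le (A := push Rg.e true) (B := pop Rg.s fun _ => skip)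
        i xr n a (un (σ + 1)) [] yr zr o hle hA
      have hbody : Runs (push Rg.s true ;; push Rg.b true ;; powS k ;;
            cmpBM (push Rg.e true) (pop Rg.s fun _ => skip))
          (mk i xr n a [] [] (un μ) (un σ) [] [] yr zr o)
          (mk i xr n a [] [] (un μ) (un (σ + 1)) [true] [] yr zr o) (cRootIter k μ) := by
        refine (h1.seq (h2.seq (hpow.seq hcmp))).of_eq rfl ?_
        unfold cRootIter; omega
      have hrec := ih (σ + 1) (by omega) hle
      have := Runs.loop_cons (k := Rg.e) (f := fun _ => push Rg.s true ;; push Rg.b true ;; powS k ;;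
          cmpBM (push Rg.e true) (pop Rg.s fun _ => skip))
        (R := mk i xr n a [] [] (un μ) (un σ) [true] [] yr zr o) (a := true) (w := []) rfl
        (by rw [update_mk_e]; exact hbody) hrec
      refine this.of_eq (by rfl) ?_
      ring_nf; omega
    · -- stop: undo the increment; the flag stays cleared and the loop exits
      push Not at hle
      have hroot : Nat.nthRoot k μ = σ := Nat.nthRoot_eq_of_le_of_lt hσ hle
      have hB : Runs (pop Rg.s fun _ => skip) (mk i xr n a [] [] (un μ) (un (σ + 1)) [] [] yr zr o)
          (mk i xr n a [] [] (un μ) (un σ) [] [] yr zr o) 2 := by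
        refine Runs.pop_cons (k := Rg.s) (a := true) (w := un σ) (by simp [un_succ]) ?_
        rw [update_mk_s]; exact Runs.skip _
      have hcmp := runs_cmpBM_gt (A := push Rg.e true) (B := pop Rg.s fun _ => skip)
        i xr n a (un (σ + 1)) [] yr zr o hle hB
      have hbody : Runs (push Rg.s true ;; push Rg.b true ;; powS k ;;
            cmpBM (push Rg.e true) (pop Rg.s fun _ => skip))
          (mk i xr n a [] [] (un μ) (un σ) [] [] yr zr o)
          (mk i xr n a [] [] (un μ) (un σ) [] [] yr zr o) (cRootIter k μ) := by
        refine (h1.seq (h2.seq (hpow.seq hcmp))).of_eq rfl ?_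
        unfold cRootIter; omega
      have hexit : Runs (rootLoop k) (mk i xr n a [] [] (un μ) (un σ) [] [] yr zr o)
          (mk i xr n a [] [] (un μ) (un σ) [] [] yr zr o) 1 := Runs.loop_nil _ rfl
      have := Runs.loop_cons (k := Rg.e) (f := fun _ => push Rg.s true ;; push Rg.b true ;; powS k ;;
          cmpBM (push Rg.e true) (pop Rg.s fun _ => skip))
        (R := mk i xr n a [] [] (un μ) (un σ) [true] [] yr zr o) (a := true) (w := []) rfl
        (by rw [update_mk_e]; exact hbody) hexit
      rw [hroot]
      refine this.of_eq rfl ?_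
      ring_nf; omega

/-- **The integer root**: from `s = []`, `m = 1^μ`, flag `e = [1]`, the program `rootLoop k`
(`k ≠ 0`) computes `s := 1^{⌊μ^{1/k}⌋}` within `(μ + 2) · (cRootIter k μ + 2) + 1` steps.
[folklore] -/
theorem runs_root {k : ℕ} (hk : k ≠ 0) (i xr n a yr zr o : List Bool) (μ : ℕ) :
    Runs (rootLoop k) (mk i xr n a [] [] (un μ) [] [true] [] yr zr o)
      (mk i xr n a [] [] (un μ) (un (Nat.nthRoot k μ)) [] [] yr zr o)
      ((μ + 2) * (cRootIter k μ + 2) + 1) := by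
  have h := runs_rootLoop hk i xr n a yr zr o μ (μ + 1) 0 (by omega)
    (by rw [Nat.zero_pow (Nat.pos_of_ne_zero hk)]; exact Nat.zero_le _)
  simpa [un] using h

/-! ### The exponential by doubling -/

/-- `dblE`: double the unary register `e` (via `f`). [folklore] -/
def dblE : Prog := loop .e (fun _ => push .f true ;; push .f true) ;; pour .f .e

/-- Effect and cost of `dblE`: `e := 1^{2ε}`. [folklore] -/
theorem runs_dblE (i xr n a b t m s yr zr o : List Bool) (ε : ℕ) :
    Runs dblE (mk i xr n a b t m s (un ε) [] yr zr o) (mk i xr n a b t m s (un (2 * ε)) [] yr zr o)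
      (10 * ε + 2) := by
  have h := runs_loop_inv (k := Rg.e) (f := fun _ => push .f true ;; push .f true)
    (fun done rest => mk i xr n a b t m s rest (un (2 * done.length)) yr zr o)
    (fun _ _ => True) 2
    (fun _ _ _ => rfl)
    (fun done c rest _ => ⟨trivial, by
      refine ((Runs.push' rfl).seq (Runs.push' ?_)).of_eq rfl (by norm_num)
      simp [un, Nat.mul_succ, List.replicate_succ]⟩)
    (un ε) [] trivial
  have h' : Runs (loop Rg.e fun _ => push Rg.f true ;; push Rg.f true)
      (mk i xr n a b t m s (un ε) [] yr zr o) (mk i xr n a b t m s [] (un (2 * ε)) yr zr o)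
      (4 * ε + 1) := by
    simpa [un] using h
  have h2 := runs_pour (Γ := Bool) (a := Rg.f) (b := Rg.e) (by decide)
    (mk i xr n a b t m s [] (un (2 * ε)) yr zr o)
  have h2' : Runs (pour Rg.f Rg.e) (mk i xr n a b t m s [] (un (2 * ε)) yr zr o)
      (mk i xr n a b t m s (un (2 * ε)) [] yr zr o) (3 * (2 * ε) + 1) := by
    simpa [un] using h2
  unfold dblE
  exact (h'.seq h2').of_eq rfl (by omega)

/-- **The exponential**: `loop s dblE` turns `s = 1^σ`, `e = 1^ε` into `s = []`,
`e = 1^{ε · 2^σ}` at cost `ExpPad.cExp σ ε`. [folklore] -/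
theorem runs_exp2 (i xr n a b t m yr zr o : List Bool) : ∀ (σ ε : ℕ),
    Runs (loop .s fun _ => dblE) (mk i xr n a b t m (un σ) (un ε) [] yr zr o)
      (mk i xr n a b t m [] (un (ε * 2 ^ σ)) [] yr zr o) (cExp σ ε)
  | 0, ε => by
    simpa [cExp] using Runs.loop_nil (fun _ => dblE) (R := mk i xr n a b t m (un 0) (un ε) [] yr zr o) rfl
  | σ + 1, ε => by
    have h1 := runs_dblE i xr n a b t m (un σ) yr zr o ε
    have h2 := runs_exp2 i xr n a b t m yr zr o σ (2 * ε)
    have := Runs.loop_cons (k := Rg.s) (f := fun _ => dblE)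
      (R := mk i xr n a b t m (un (σ + 1)) (un ε) [] yr zr o) (a := true) (w := un σ) rfl
      (by simpa using h1) h2
    refine this.of_eq ?_ (by simp [cExp])
    simp [pow_succ]; ring_nf

/-- Closed-form bound for the doubling cost: `cExp σ ε ≤ 10 ε 2^σ + 4 σ + 1`. [folklore] -/
theorem cExp_le (σ ε : ℕ) : cExp σ ε ≤ 10 * ε * 2 ^ σ + 4 * σ + 1 := by
  have := cExp_eq σ ε
  omega

end PolyExistsNTIME

end Literature.Computability.Complexity
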